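import Summits.MatrixMultiplication.OmegaCensus.STPPCrossReadingCosetClash
import Summits.MatrixMultiplication.OmegaCensus.STPPKernelListerOrderN35D
import Summits.MatrixMultiplication.OmegaCensus.STPPKernelListerOrderN33
import Summits.MatrixMultiplication.OmegaCensus.STPPPatternMonotonicity
import Summits.MatrixMultiplication.OmegaCensus.STPPAlignedBlockFilter

/-!
# ω-census (abelian STPP census): NO beating STPP family in any abelian group of order `35` — UNCONDITIONAL, by cross-reading coset clashes (kernel)

HONEST FRAMING (pub-omega census; verbatim): lottery ticket; floor = certified bounds/negative ranges.
Census STRUCTURE (seat pub-omega-stpp-2 gen 31, 2026-08-29), family (b2).  The two survivors of the kernel lister at order `35` (`deadN35 =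
{233_233, 233_323}`, `…OrderN35D.lean`, stpp-2 g30; no prime-order Vosper law applies at `35 = 5·7`, and none of the tree's card-vector filters
N8–N20 fires) are killed by the composite-order substitute for Vosper of `STPPCrossReadingCosetClash.lean`: Kneser's theorem with the stabilizer
PINNED by the arithmetic of the N18 chain, read in TWO role orders.
* `{(2,3,3),(2,3,3)}`: reading `(A,B,C)` at block `0` pins the outer stabilizer to order `7` and puts `B₀` in one coset of it; reading `(A,C,B)` (the
  family `(−A,−C,−B)`) does the same for `C₀`; the subgroup of order `7` is unique (`49 ∤ 35`), so `C₀ − B₀` lies in one coset — but it has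
  `|B₀||C₀| = 9 > 7` elements (TPP).
* `{(2,3,3),(3,2,3)}`: reading `(A,B,C)` at block `0` pins the outer stabilizer to order `5` (`B₀` in one coset); reading `(C,A,B)` at block `1` pins the
  INNER stabilizer to order `7` and puts `Y° = B₀ − A₀` in one coset, hence `B₀` in one coset of a subgroup of order `7`; cosets of subgroups of orders
  `5` and `7` share at most one point — but `|B₀| = 3`.
Hence `volume_le_of_card_eq_35` (every abelian group of order 35, i.e. `ℤ₃₅`; all `m`, all entries) and, with `volume_le_card_of_card_le_34`, the law
`volume_le_card_of_card_le_35`.  Nothing here is progress on `ω`.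

References: M. Kneser, Math. Z. 58 (1953); H. Cohn, R. Kleinberg, B. Szegedy, C. Umans, FOCS 2005 (arXiv:math/0511460), Def. 5.1.
-/

open Finset
open scoped Pointwise

namespace Summit.MatrixMultiplication.OmegaCensus.CubeNB

open Literature.Computability.AlgebraicComplexity
open Literature.Combinatorics.Additive
open Summit.MatrixMultiplication.OmegaCensus.STPPKneser

variable {H : Type*} [AddCommGroup H] [DecidableEq H] [Fintype H]

omit [Fintype H] in
/-- From `⋃_{k≠i}(C_k − B_k) ⊆ y + K′`: each `C_k` (`k ≠ i`) lies in one coset of `K′`. [folklore] -/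
theorem last_subset_coset_of_DU_subset {N : ℕ} {B C : Fin N → Finset H} {K' : Finset H} (hK' : IsSubgroupCarrier K') {i k : Fin N} (hk : k ≠ i) {y : H}
    (h : DU B C (univ.erase i) ⊆ y +ᵥ K') {b : H} (hb : b ∈ B k) : C k ⊆ (y + b) +ᵥ K' := by
  intro c hc
  have hmem : c - b ∈ DU B C (univ.erase i) := by
    refine Finset.mem_biUnion.2 ⟨k, Finset.mem_erase.2 ⟨hk, Finset.mem_univ _⟩, ?_⟩
    exact mem_D.2 ⟨b, hb, c, hc, rfl⟩
  have h1 := (hK'.mem_coset_iff).1 (h hmem)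
  rw [hK'.mem_coset_iff]
  have : c - (y + b) = c - b - y := by abel
  rw [this]
  exact h1

/-- **`{(2,3,3),(2,3,3)}` has no STPP realisation in any abelian group of order `35`** (cross-reading coset clash, equal prime order `7`).
[cite: Kneser1953] [cite: CohnKleinbergSzegedyUmans2005, Def. 5.1] -/
theorem no_isSTPP_card35_233_233 (hH : Fintype.card H = 35) (A B C : Fin 2 → Finset H) (hS : IsSTPP A B C)
    (hA : ∀ i, #(A i) = ![2, 2] i) (hB : ∀ i, #(B i) = ![3, 3] i) (hC : ∀ i, #(C i) = ![3, 3] i) : False := by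
  have hAne : ∀ i, (A i).Nonempty := fun i => card_pos.1 (by rw [hA]; fin_cases i <;> simp)
  have hBne : ∀ i, (B i).Nonempty := fun i => card_pos.1 (by rw [hB]; fin_cases i <;> simp)
  have hCne : ∀ i, (C i).Nonempty := fun i => card_pos.1 (by rw [hC]; fin_cases i <;> simp)
  have e0 : (univ : Finset (Fin 2)).erase 0 = {1} := by decide
  have hI : ((univ : Finset (Fin 2)).erase 0).Nonempty := ⟨1, by decide⟩
  -- reading (A,B,C) at block 0: B₀ in one coset of K₁, #K₁ = 7
  obtain ⟨K₁, hK₁, hK₁7, b, hb, hB0⟩ := exists_carrier_middle_subset_coset' hS hAne hBne hCne 0 hI (n := 35) (q := 7)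
    (z := 6) (b := 3) (vol := 18) (a := 2) (L := 9) hH (by rw [hA]; rfl) (by rw [hB]; rfl) (by rw [hA, hB, hC]; rfl)
    (by rw [e0, sum_singleton, hA, hC]; rfl) (by rw [e0, sum_singleton, hB, hC]; rfl) (by decide)
  -- reading (A,C,B): the family (−A, −C, −B); block 0: −C₀ in one coset of K₂, #K₂ = 7
  have hR : IsSTPP (fun j => -(A j)) (fun j => -(C j)) (fun j => -(B j)) := stpp_rotate (stpp_rotate (isSTPP_neg_reverse hS))
  obtain ⟨K₂, hK₂, hK₂7, c, hc, hC0⟩ := exists_carrier_middle_subset_coset' hR (nonempty_neg_family hAne) (nonempty_neg_family hCne)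
    (nonempty_neg_family hBne) 0 hI (n := 35) (q := 7) (z := 6) (b := 3) (vol := 18) (a := 2) (L := 9) hH
    (by rw [card_neg_family, hA]; rfl) (by rw [card_neg_family, hC]; rfl) (by rw [card_neg_family, card_neg_family, card_neg_family, hA, hB, hC]; rfl)
    (by rw [e0, sum_singleton, card_neg_family, card_neg_family, hA, hB]; rfl)
    (by rw [e0, sum_singleton, card_neg_family, card_neg_family, hC, hB]; rfl) (by decide)
  -- the subgroup of order 7 is unique
  have hK : K₁ = K₂ := eq_of_card_eq_prime hK₁ hK₂ (by norm_num) hK₁7 hK₂7 (by rw [hH]; norm_num)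
  subst hK
  -- C₀ − B₀ lies in one coset of K₁
  have hc' : -c ∈ C 0 := by simpa using hc
  have hD : D B C 0 ⊆ (-c - b) +ᵥ K₁ := by
    intro x hx
    obtain ⟨b', hb', c', hc', rfl⟩ := mem_D.1 hx
    have h1 : b' - b ∈ K₁ := (hK₁.mem_coset_iff).1 (hB0 hb')
    have h2 : -c' - c ∈ K₁ := (hK₁.mem_coset_iff).1 (hC0 (by simpa using hc'))
    rw [hK₁.mem_coset_iff]
    have : c' - b' - (-c - b) = -(-c' - c) - (b' - b) := by abel
    rw [this]
    exact hK₁.sub_mem (hK₁.neg_mem h2) h1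
  have := Finset.card_le_card hD
  rw [Finset.card_vadd_finset, hK₁7, card_D_BC hS hAne 0, hB, hC] at this
  exact absurd this (by decide)

/-- **`{(2,3,3),(3,2,3)}` has no STPP realisation in any abelian group of order `35`** (cross-reading coset clash, coprime orders `5`, `7`).
[cite: Kneser1953] [cite: CohnKleinbergSzegedyUmans2005, Def. 5.1] -/
theorem no_isSTPP_card35_233_323 (hH : Fintype.card H = 35) (A B C : Fin 2 → Finset H) (hS : IsSTPP A B C)
    (hA : ∀ i, #(A i) = ![2, 3] i) (hB : ∀ i, #(B i) = ![3, 2] i) (hC : ∀ i, #(C i) = ![3, 3] i) : False := by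
  have hAne : ∀ i, (A i).Nonempty := fun i => card_pos.1 (by rw [hA]; fin_cases i <;> simp)
  have hBne : ∀ i, (B i).Nonempty := fun i => card_pos.1 (by rw [hB]; fin_cases i <;> simp)
  have hCne : ∀ i, (C i).Nonempty := fun i => card_pos.1 (by rw [hC]; fin_cases i <;> simp)
  have e0 : (univ : Finset (Fin 2)).erase 0 = {1} := by decide
  have e1 : (univ : Finset (Fin 2)).erase 1 = {0} := by decide
  -- reading (A,B,C) at block 0: B₀ in one coset of K₁, #K₁ = 5
  obtain ⟨K₁, hK₁, hK₁5, b, hb, hB0⟩ := exists_carrier_middle_subset_coset' hS hAne hBne hCne 0 ⟨1, by decide⟩ (n := 35) (q := 5)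
    (z := 9) (b := 3) (vol := 18) (a := 2) (L := 6) hH (by rw [hA]; rfl) (by rw [hB]; rfl) (by rw [hA, hB, hC]; rfl)
    (by rw [e0, sum_singleton, hA, hC]; rfl) (by rw [e0, sum_singleton, hB, hC]; rfl) (by decide)
  -- reading (C,A,B) at block 1: Y° = B₀ − A₀ in one coset of K₂, #K₂ = 7
  have hR : IsSTPP C A B := stpp_rotate (stpp_rotate hS)
  obtain ⟨K₂, hK₂, hK₂7, y, hY⟩ := exists_carrier_DU_subset_coset' hR hCne hAne hBne 1 ⟨0, by decide⟩ (n := 35) (q' := 7)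
    (z := 9) (b := 3) (vol := 18) (a := 3) (L := 6) hH (by rw [hC]; rfl) (by rw [hA]; rfl) (by rw [hC, hA, hB]; rfl)
    (by rw [e1, sum_singleton, hC, hB]; rfl) (by rw [e1, sum_singleton, hA, hB]; rfl) (by decide)
  obtain ⟨a, ha⟩ := hAne 0
  have hB0' : B 0 ⊆ (y + a) +ᵥ K₂ := last_subset_coset_of_DU_subset hK₂ (show (0 : Fin 2) ≠ 1 by decide) hY ha
  -- cosets of subgroups of coprime orders 5, 7 share at most one point
  have h01 : K₁ ∩ K₂ = {0} := inter_eq_zero_of_coprime hK₁ hK₂ (by rw [hK₁5, hK₂7]; decide)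
  have := card_le_one_of_subset_cosets hK₁ hK₂ h01 hB0 hB0'
  rw [hB] at this
  exact absurd this (by decide)

/-! ## The order-35 capstone -/

section Capstone

open Summit.MatrixMultiplication.OmegaCensus.KLister

/-- `233_233` is not realisable in any abelian group of order `35`. [cite: CohnKleinbergSzegedyUmans2005, Def. 5.1] -/
theorem notRealizable_card35_233_233 (hH : Fintype.card H = 35) : ¬ Realizable H ([(2, 3, 3), (2, 3, 3)] : List Shape) := by
  intro h
  obtain ⟨A, B, C, hS, hc⟩ := h.out
  exact no_isSTPP_card35_233_233 hH A B C hS (fun i => by fin_cases i <;> exact (hc _).2.2.2.1)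
    (fun i => by fin_cases i <;> exact (hc _).2.2.2.2.1) (fun i => by fin_cases i <;> exact (hc _).2.2.2.2.2)

/-- `233_323` is not realisable in any abelian group of order `35`. [cite: CohnKleinbergSzegedyUmans2005, Def. 5.1] -/
theorem notRealizable_card35_233_323 (hH : Fintype.card H = 35) : ¬ Realizable H ([(2, 3, 3), (3, 2, 3)] : List Shape) := by
  intro h
  obtain ⟨A, B, C, hS, hc⟩ := h.out
  exact no_isSTPP_card35_233_323 hH A B C hS (fun i => by fin_cases i <;> exact (hc _).2.2.2.1)
    (fun i => by fin_cases i <;> exact (hc _).2.2.2.2.1) (fun i => by fin_cases i <;> exact (hc _).2.2.2.2.2)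

end Capstone

end Summit.MatrixMultiplication.OmegaCensus.CubeNB

namespace Summit.MatrixMultiplication.OmegaCensus.KLister

open Literature.Computability.AlgebraicComplexity
open Summit.MatrixMultiplication.OmegaCensus.CubeNB

/-- **Order 35: no beating STPP family (kernel, unconditional, every abelian group of order 35).** [cite: CohnKleinbergSzegedyUmans2005, Def. 5.1] [cite: Kneser1953] -/
theorem volume_le_of_card_eq_35 {H : Type*} [AddCommGroup H] [Fintype H] [DecidableEq H] (hH : Fintype.card H = 35)
    {m : ℕ} (A B C : Fin m → Finset H) (hS : IsSTPP A B C) : ∑ i, #(A i) * #(B i) * #(C i) ≤ 35 := by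
  refine volume_le_of_card_eq_35_of_dead hH ?_ A B C hS
  intro D hD
  simp only [deadN35, List.mem_cons, List.not_mem_nil, or_false] at hD
  rcases hD with rfl | rfl
  · exact notRealizable_card35_233_233 hH
  · exact notRealizable_card35_233_323 hH

/-- **Every abelian group of order `≤ 35` admits no beating STPP family** (`≤ 34`: `volume_le_card_of_card_le_34`; `35`: above).
[cite: CohnKleinbergSzegedyUmans2005, Def. 5.1] -/
theorem volume_le_card_of_card_le_35 {H : Type*} [AddCommGroup H] [Fintype H] [DecidableEq H] (hH : Fintype.card H ≤ 35)
    {m : ℕ} (A B C : Fin m → Finset H) (hS : IsSTPP A B C) : ∑ i, #(A i) * #(B i) * #(C i) ≤ Fintype.card H := by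
  rcases Nat.lt_or_ge (Fintype.card H) 35 with h | h
  · exact volume_le_card_of_card_le_34 (by omega) A B C hS
  · have h35 : Fintype.card H = 35 := by omega
    rw [h35]; exact volume_le_of_card_eq_35 h35 A B C hS

end Summit.MatrixMultiplication.OmegaCensus.KLister
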